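import Literature.NumberTheory.EllipticCurves.Kim2026.ShaLengthRankZeroUpperBound
import HarnessLib

/-!
# Kim 2025 (arXiv:2505.09121v1, PREPRINT): the structure theorem for Selmer groups at EVERY prime
# `p ≥ 3` under LARGE `p`-adic image — the ANNOUNCED `p = 3` case of Kim 2026 Thm. 1.8 (6), typed as
# explicitly labelled OPEN hypotheses (three `def … : Prop`, nothing asserted)

Topic `NumberTheory/EllipticCurves`, sub-directory `Kim2025` (author–year; namespace = path,
`Literature.NumberTheory.EllipticCurves.Kim2025`). Written for the residual cell `b2b-bsdres`
(run/shared/lean/b2b/bsd-rank1-residual/; team n1011 = classes N10/N11 of RESIDUAL-MAP §I: X4 =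
additive `p`, `E[p]` irreducible, at `p = 3`; seat n1011-p09, OWNERS row T-a4). HONEST FRAMING
(cell, verbatim): the goal is to DELETE the COMBINATION-SHAPED residual classes of the BSD formula for
ALL analytic-rank `≤ 1` curves over `ℚ` from PUBLISHED theorems only, and to TYPE what is not
published; this is not "finishing BSD". An ANNOUNCED preprint enters ONLY as an explicitly labelled
OPEN hypothesis (`_OPEN`, `[claim: …, status: under-review]`), never as a theorem. Nothing below is a
theorem of the tree; a result using one of the three `Prop`s is conditional on an unrefereed claim.

## Why this file exists (the located gap of class N11)

RESIDUAL-MAP §I N11 (the largest single block of the rank-`≤ 1` residue: X4 ∧ `r = 0` ∧ `p = 3` ∧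
surj(3)) reads "Kim 2026 Thm 1.8 (6) at `p = 3` — not in print: Kim's Euler-system argument uses
`p ≥ 5`". The `p ≥ 5` is located by the source itself — C.-H. Kim, Amer. J. Math. 148 (2026) =
arXiv:2203.12159v4, §1.2.5 (PDF p. 5): "If `ρ̄` is surjective and `p ≥ 5`, then all the required
hypotheses for the Kolyvagin system argument are satisfied [mazur-rubin-book]. … The `p ≥ 5`
condition is required only for the Chebotarev density type argument in [mazur-rubin-book], and it
seems possible to extend to the `p = 3` case following the recent work of Sakamoto" — i.e.
Mazur–Rubin's hypothesis (H.4) ("`Hom_{𝔽_p[[G_ℚ]]}(T̄, T̄^*(1)) = 0` or `p > 4`", Mem. AMS 799 p. 27),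
which fails for the self-dual `E[3]`. That extension is now IN PRINT in two steps:

1. **R. Sakamoto, *The theory of Kolyvagin systems for `p = 3`*, J. Théor. Nombres Bordeaux 36
   (2024) 919–946 (REFEREED).** Thm. 1.1 (= Thm. 4.4), p. 920: "Suppose that `p = 3`, `T` is
   residually self-dual, that is, `T̄ ≅ T̄^∨(1)` as `G_K`-representations, and `𝓕` is residually
   coisotropic. Then the module of Kolyvagin systems are free of rank `1` and its basis controls the
   initial Fitting ideal of the dual Selmer module associated with `𝓕`." (standing hypotheses
   (H.1)–(H.3) + (H.SD), p. 921; the `p = 3` Chebotarev lemma = Lemma 5.2 / Cor. 5.5; elliptic curves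
   over `ℚ` at `3` = §9.) Its predecessor R. Sakamoto, Doc. Math. 27 (2022) App. A [Sakamoto2022pSelmer]
   repairs the rank-`0` mod-`p` theory only.
2. **C.-H. Kim (appendix with R. Pollack), *The refined Tamagawa number conjectures for `GL₂`*,
   arXiv:2505.09121v1 (May 2025; UNREFEREED PREPRINT — no journal version as of 2026-08-21, cell
   FRESHNESS watch-list).** Verbatim (held text `paper:arxiv-2505.09121`):
   * §1.1.1 (PDF p. 4): "We say that `ρ_f` has large image if the image of `Gal(ℚ̄/ℚ(ζ_{p^∞}))`
     under `ρ_f` contains a conjugate of `SL₂(ℤ_p)`."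
   * **Theorem 1.1** (Main Theorem I, PDF p. 5): "Let `f ∈ S_k(Γ₀(N))` be a newform and `p ≥ 3` a
     prime such that `ρ_f` has large image. If the collection of Kurihara numbers `δ^{min,†}` for
     `f` at `s = k/2` does not vanish, then … (Str) … `Sel(ℚ, W_f^†) ≃ (F/𝒪)^{⊕ ord(δ^{min,†})} ⊕
     ⨁_{i≥0} (𝒪/π^{e_i}𝒪)^{⊕2}` … ("BSD") `cork_𝒪 Sel(ℚ, W_f^†) = ord(δ^{min,†})`,
     `length_𝒪 Sel(ℚ, W_f^†)_{/div} = ∂^{(ord(δ^{min,†}))}(δ^{min,†}) − ∂^{(∞)}(δ^{min,†})`."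
     Followed by: "Theorem 1.1 is independent of weight or the local behavior of `f` at `p`."
   * **Theorem 1.2** (PDF p. 5): "Let `f ∈ S_k(Γ₀(N))` be a newform and `p ≥ 3` a prime such that
     `ρ_f` has large image. If one of the following conditions is satisfied: (rk0)
     `ord_{s=k/2} L(f,s) = 0`, … then `δ^{min,†}` does not vanish." (Proof: "The (rk0) case is trivial.")
   * **Corollary 1.7** (PDF p. 6): "Let `f ∈ S_k(Γ₀(N))` be a newform and `p ≥ 3` a prime such that
     `ρ_f` has large image. If `L(f, k/2) ≠ 0`, then `length_𝒪 Sel(ℚ, W_f^†) =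
     ord_π( L(f̄,k/2) / ((−2π√−1)^{k/2} · Ω^±_{f̄,min}) ) − ∂^{(∞)}(δ^{min,†})` where the sign of the
     minimal integral period coincides with that of `(−1)^{k/2−1}`."
   * Def. 2.2 / Rem. 2.3 (PDF p. 10): minimal integral periods `Ω^±_{f,min}`, unique up to `𝒪^×`,
     make every period integral `λ^±(z^{r−1}; a, n)/Ω^±` lie in `𝒪`, one of them a unit; "If we
     require [integrality] only, we just call them (non-minimal) integral periods." §1.4.4 (PDF
     p. 8): "Any non-minimal integral periods can play the exactly same role in Theorems 1.1 and
     1.8 without any modification because the difference will be cancelled out."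
   * §1.1.2 (PDF p. 4): `𝒩_m` = square-free products of primes `ℓ ∤ Np` with `ℓ ≡ 1 (mod π^m)` and
     `a_ℓ ≡ ℓ^{k−1} + 1 (mod π^m)`; `I_n = (ℓ − 1, 1 − a_ℓ + ℓ^{k−1} : ℓ ∣ n)`; Def. 2.4 (PDF p. 10):
     `δ^{min,r}_n = ∑_{a ∈ (ℤ/n)ˣ} \overline{λ^{±,min}(z^{r−1}; a, n)} · ∏_{ℓ∣n} \overline{log_{η_ℓ}(a)}`.
   * **§3.2.2** (PDF p. 11): "When `p > 3`, the large image assumption is strong enough to satisfy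
     all the working hypotheses for Kolyvagin systems [mazur-rubin-book]. When `p = 3` and
     `Hom(ρ̄_f^†, Hom(ρ̄_f^†, 𝔽(1))) ≠ 0`, we need a more argument following [sakamoto-p-3]. In
     [mazur-rubin-book], the condition `p > 3` is used only in the refined Chebotarev density result
     below and its consequences." — Prop. 3.3 (Mazur–Rubin, `p > 3`), **Prop. 3.4 (Sakamoto,
     `p = 3`)**, Prop. 3.5 (useful primes), Thm. 3.8 ("The graph `𝒳⁰` is connected. Proof. See
     [mazur-rubin-book] and [sakamoto-p-3]."), Thms. 3.9–3.12 (structure / rigidity at `p ≥ 3`).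
   * Appendix A.1.1 (Kim–Pollack; arXiv v1 PDF pp. 33–34 — numbered "§8.1.1", chunk p0026, in the held
     TeX-derived text `paper:arxiv-2505.09121`, locator erratum 2026-08-25): Thm. 1.1 applied AT `p = 3` to curves with ADDITIVE
     reduction at `3` — 19215.x1, 22077.g1, 73206.r1, 83790.b1, 84825.y1: `Ш(E/ℚ)[3^∞] ≅ (ℤ/9ℤ)^{⊕2}`
     from `δ̃_{ℓ₁ℓ₂} ≠ 0`; App. A.1.2 (PDF p. 34; held "§8.1.2"): a Tamagawa defect at `3` (20787.e1, `3 ∣ c₄₁`) read at level `𝒩₂`.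

## The three `Prop`s below (weaker than the announced print, never stronger)

They are the `p ≥ 3` LARGE-IMAGE twins of three facts already in the tree for `p ≥ 5` —
`Kim2026.rankZero_padicValNat_sha_le_of_maninConstant` (file `Kim2026/ShaLengthRankZeroUpperBound`),
`Kim2022_rankZero_padicValRat_sha_of_kuriharaNumber_ne_zero_of_maninConstant` and
`Kim2022_rankOne_card_sha_eq_one_of_kuriharaNumber_ne_zero_of_maninConstant` (file
`KuriharaNumberKimShaLength`) — with EXACTLY their binders except that `5 ≤ p → ρ̄_{E,p} surjective`
becomes `3 ≤ p → ρ̄_{E,p^n} surjective for every n` (at `p ≥ 5` the two agree by Serre; at `p = 3`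
surj(3) does NOT give surj(9) — Elkies 2006 — and the tower is the cell's certificate bit: surj(9),
a `j`-witness, (ram), Wuthrich L. 20). Dictionary and the one-line derivations:
* `f = f_E`, `k = 2`, `F = ℚ_p`, `𝒪 = ℤ_p`; `T_f` = any stable lattice of `V_pE`, homothetic to
  `T_pE` since `E[p]` is irreducible, so `W_f^† = W_f(1) ≅ E[p^∞]` and `Sel(ℚ, W_f(1))` (Bloch–Kato
  structure, §2.2.2) is the classical `Sel_{p^∞}(E/ℚ)` (Bloch–Kato 1990 Ex. 3.11: `H¹_f = ` Kummer
  image for abelian varieties at every place). LARGE IMAGE ⇐ TOWER: if `ρ̄_{E,p^n}` is onto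
  `GL₂(ℤ/p^n)` for all `n` then `ρ_{E,p^∞}(G_ℚ) = GL₂(ℤ_p)` (closed of dense image) and
  `ρ(G_{ℚ(μ_{p^∞})}) = ρ(ker χ_cyc) = SL₂(ℤ_p)` (`det ρ = χ_cyc`).
* RANK ZERO: `L(E,1) ≠ 0` ⇒ (rk0) ⇒ `δ^{min}` does not vanish (Thm. 1.2), `ord(δ^{min}) = 0`;
  `E(ℚ)` finite ⇒ `E(ℚ) ⊗ ℚ_p/ℤ_p = 0` ⇒ `Sel_{p^∞}(E/ℚ) = Ш(E/ℚ)[p^∞]` (finite by hypothesis), so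
  Cor. 1.7 reads `length_{ℤ_p} Ш(E/ℚ)[p^∞] = ord_p(L(E,1)/Ω_min) − ∂^{(∞)}(δ^{min})`, `Ω_min :=
  (−2π√−1)·Ω^+_{f,min} ∈ ℝ`. PERIOD: the binders carry a modular parametrisation datum `D` of the
  globally minimal `W` with `p ∤ c_D` (Kim's AJM hypothesis (ii), "needed only when `E` has additive
  reduction at `p`", AJM §1.3.5); then the Néron period `Ω(W) = W.realPeriodRat` is a (possibly
  non-minimal) INTEGRAL period: `φ_D^* ω_W = c_D · 2πi f dz` puts the periods of `2πi f dz` in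
  `c_D^{-1} Λ_W`, and `{∞, a/n}_f ∈ m^{-1} c_D^{-1} Λ_W` with `m` the order of the cuspidal divisor
  `(a/n) − (∞)` pushed to `W(ℚ(μ_N))_tors` (Manin 1972 Thm. 3.5 / Manin–Drinfeld), `p ∤ m` because
  `E[p](ℚ(μ_N)) = 0` under large image (a `G_ℚ`-stable line fixed by an abelian-extension subgroup
  would make `ℚ(E[p])/ℚ` abelian); hence `re{∞, a/n}_f / Ω(W) ∈ (2 m c_D)^{-1} ℤ ⊂ ℤ_(p)` (`p` odd)
  — the sentence Kim AJM §1.4.1 prints as "Under our assumptions, we have `[r]⁺ ∈ ℤ_(p)`" and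
  Sakamoto JTNB 2024 §9.2.2 as "Since the image of `G_ℚ → Aut(T₃(E)) ≅ GL₂(ℤ₃)` contains
  `SL₂(ℤ₃)`, we have `Re([a/d])/Ω⁺_E ∈ ℤ₃ (see [Manin 1972, Theorem 3.5])`". By §1.4.4 / Rem. 2.3
  the formula holds verbatim with `Ω(W)`-normalised (integral) Kurihara numbers `δ̃_n`, whose
  `∂^{(∞)} ≥ 0`; so (a) `ord_p #Ш(E/ℚ)(p) ≤ ord_p(L(E,1)/Ω(W))` — the INEQUALITY
  `rankZero_padicValNat_sha_le_of_towerSurj_OPEN`; (b) if ONE `δ̃_n`, `n ∈ 𝒩_1`, is a `p`-adic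
  unit then `∂^{(ν(n))} = 0 = ∂^{(∞)}` and `ord_p #Ш(E/ℚ)(p) = ord_p(L(E,1)/Ω(W))` — the EQUALITY
  `rankZero_padicValRat_sha_of_kuriharaNumber_ne_zero_of_towerSurj_OPEN`, with the tree's
  `kuriharaNumber D.f p n ψ` (`Ω⁺_f`-normalised) and the period transfer `Ω(W) = u·Ω⁺_{D.f}`,
  `|u|_p = 1`, exactly as in the `Kim2022_…_of_maninConstant` sibling (non-vanishing of a unit multiple).
* RANK ONE: `L(E,1) = 0` ⇒ `δ̃_1 = 0`; a unit `δ̃_ℓ` at a Kolyvagin prime `ℓ ∈ 𝒫_1` witnesses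
  "`δ^{min}` does not vanish" with `ord(δ^{min}) = 1` and `∂^{(1)} = ∂^{(∞)} = 0`; Thm. 1.1 ("BSD")
  gives `cork Sel_{p^∞}(E/ℚ) = 1` and `length Sel_{/div} = 0`; with `ord_{s=1} L(E,s) = 1`,
  `rk E(ℚ) = 1` and `Ш(E/ℚ)` finite (binders, Gross–Zagier–Kolyvagin) the divisible part of `Sel` is
  `E(ℚ) ⊗ ℚ_p/ℤ_p` and `Ш(E/ℚ)[p^∞] ≅ Sel_{/div} = 0`: `#Ш(E/ℚ)(p) = 1` —
  `rankOne_card_sha_eq_one_of_kuriharaNumber_ne_zero_of_towerSurj_OPEN`. (Thm. 1.2 (rk1+ε) with its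
  `p² ∤ N` is NOT used: the certificate itself is the non-vanishing.)
* LEVELS: as in every sibling the cyclicity condition `#Ẽ(𝔽_ℓ)[p] ≤ p` at `ℓ ∣ n` of the printed
  PROOF (useful primes `τ`, Mazur–Rubin / Sakamoto) is ADDED — weaker than the literal `𝒩_1`.
Weaker than print in every respect (inequality / certificate shapes of an equality; `Finite W.sha`;
period binder; cyclicity flag); the large-image hypothesis is rendered by the (stronger) full tower
surjectivity. No `_holds` (size XL: Kato's Euler system, Mazur–Rubin, Sakamoto 2024, Kim 2025 §§3–5).
STATUS: PREPRINT ⇒ every declaration is `_OPEN` with `[claim: Kim2025RefinedTNC, status: under-review]`;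
the cited REFEREED input at `p = 3` is Sakamoto 2024. Consumers (cell): `Summits/BirchSwinnertonDyer/
Rank1Residual/Additive/X4SharpThreeKimLargeImage.lean` (X4♯(3) on tower-surjective rows; LOWER@3 from
one unit Kurihara number; O7 ∩ X4@3).

## References
* C.-H. Kim (appendix with R. Pollack), arXiv:2505.09121v1 (2025), §1.1.1–1.1.3, Thm. 1.1, Thm. 1.2,
  Cor. 1.7, §1.4.4, Def. 2.2, Rem. 2.3, Def. 2.4, §3.2.2 (Props. 3.3–3.5), Thm. 3.8, App. A.1 (printed
  numbering; the held TeX-derived text numbers the appendix as §8). [Kim2025RefinedTNC]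
* R. Sakamoto, J. Théor. Nombres Bordeaux 36 (2024) 919–946, Thm. 1.1 = Thm. 4.4, §2 (H.1)–(H.3),
  (H.SD), Lemma 5.2, Cor. 5.5, §9 (Prop. 9.5, Cor. 9.6, §9.2.2, Thm. 9.11). [Sakamoto2024KolyvaginThree]
* R. Sakamoto, Doc. Math. 27 (2022) 1891–1922, App. A. [Sakamoto2022pSelmer]
* C.-H. Kim, Amer. J. Math. 148 (2026) 79–129 = arXiv:2203.12159v4, §1.2.5, §1.3.5, §1.4.1, Thm. 1.9. [Kim2022StructureSelmer]
* B. Mazur, K. Rubin, *Kolyvagin systems*, Mem. AMS 799 (2004), §3.5 (H.4), Prop. 3.6.1.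
* Ju. I. Manin, Izv. Akad. Nauk SSSR 36 (1972), Thm. 3.5. [Manin1972]
-/

noncomputable section

open scoped MatrixGroups ModularForm Classical

open CongruenceSubgroup Literature.NumberTheory.EllipticCurves.ModularForms

namespace Literature.NumberTheory.EllipticCurves.Kim2025

/-- **OPEN HYPOTHESIS — UNREFEREED PREPRINT (arXiv:2505.09121v1, 2025), Thm. 1.1 ("BSD") with
Thm. 1.2 (rk0) and Cor. 1.7, read in weight `2`, analytic rank `0`: the certificate-free UPPER BOUND
at EVERY prime `p ≥ 3` under large `p`-adic image, ANY reduction type at `p` (additive included).**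
"Let `f ∈ S_k(Γ₀(N))` be a newform and `p ≥ 3` a prime such that `ρ_f` has large image. If
`L(f, k/2) ≠ 0`, then `length_𝒪 Sel(ℚ, W_f^†) = ord_π( L(f̄,k/2)/((−2π√−1)^{k/2}·Ω^±_{f̄,min}) ) −
∂^{(∞)}(δ^{min,†})`" (Cor. 1.7; "independent of weight or the local behavior of `f` at `p`").
Transcribed (module docstring, RANK ZERO, for the dictionary and the period step): `W/ℚ` globally
minimal elliptic, `p ≥ 3` prime with `ρ̄_{E,p^n}` surjective for every `n` (⇒ large image),
`L(E,1) ≠ 0`, `Ш(E/ℚ)` finite, `D` a modular parametrisation datum of `W` with `p ∤ c_D` (so that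
`Ω(W)` is an integral period, §1.4.4 / Rem. 2.3 / Kim AJM §1.4.1 / Manin 1972 Thm. 3.5): then
`L(E,1)/Ω(W) = q ∈ ℚ` with `ord_p #Ш(E/ℚ)(p) ≤ ord_p q` (`= ord_p q − ∂^{(∞)}`, `∂^{(∞)} ≥ 0`). The
`p = 3` case rests on Sakamoto, JTNB 36 (2024) Thm. 1.1 (REFEREED) via Kim's §3.2.2 / Prop. 3.4 /
Thm. 3.8. The `p ≥ 5` twin with `ρ̄_{E,p}` surjective is the PUBLISHED tree fact
`Kim2026.rankZero_padicValNat_sha_le_of_maninConstant`; use that one at `p ≥ 5`. NEVER cite this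
`Prop` as a theorem; take it as an explicit hypothesis `(hKim25 : Kim2025.…_OPEN)`. Weaker than the
announced print, never stronger. [claim: Kim2025RefinedTNC, status: under-review]
[cite: Kim2025RefinedTNC, Thm. 1.1, Thm. 1.2 (rk0), Cor. 1.7 (PDF pp. 5–6), §1.4.4, Def. 2.2, Rem. 2.3, §3.2.2, Thm. 3.8 (ANNOUNCED, typed as an OPEN hypothesis, nothing asserted)]
[cite: Sakamoto2024KolyvaginThree, Thm. 1.1 = Thm. 4.4 (p. 920), Lemma 5.2, Cor. 5.5]
[cite: Kim2022StructureSelmer, §1.2.5 (PDF p. 5), §1.3.5 (PDF p. 6), §1.4.1 (PDF p. 7)] -/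
def rankZero_padicValNat_sha_le_of_towerSurj_OPEN : Prop :=
  ∀ (W : WeierstrassCurve ℚ) [W.IsElliptic] [W.IsGloballyMinimal] (p : ℕ) [Fact p.Prime],
    3 ≤ p → (∀ n : ℕ, W.HasSurjectiveModNGaloisRep (p ^ n : ℕ)) →
    W.entireLFunction 1 ≠ 0 → Finite W.sha →
    ∀ {N : ℕ} [NeZero N] (D : ModularParametrizationData W N),
    ¬ (p : ℤ) ∣ D.maninConstant →
    ∃ q : ℚ, W.entireLFunction 1 / (W.realPeriodRat : ℂ) = (q : ℂ) ∧
      (padicValNat p (Nat.card (AddCommGroup.primaryComponent W.sha p)) : ℤ) ≤ padicValRat p q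

/-- **OPEN HYPOTHESIS — UNREFEREED PREPRINT (arXiv:2505.09121v1, 2025), Thm. 1.1 ("BSD") with
Thm. 1.2 (rk0) and Cor. 1.7, weight `2`, analytic rank `0`, a UNIT Kurihara number: the EQUALITY
`ord_p #Ш(E/ℚ)(p) = ord_p(L(E,1)/Ω(W))` at EVERY prime `p ≥ 3` under large `p`-adic image, ANY
reduction type at `p`.** Same announced statement as the previous `Prop`; here ONE level `n ∈ 𝒩_1`
(`ℓ ∤ Np`, `ℓ ≡ 1`, `a_ℓ ≡ ℓ + 1 (mod p)` for `ℓ ∣ n`; cyclicity flag `#Ẽ(𝔽_ℓ)[p] ≤ p` of the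
printed proof added) carries a Kurihara number that is a `p`-adic unit — in the tree's normalisation
`kuriharaNumber D.f p n ψ ≠ 0` for surjective discrete logarithms `ψ_ℓ : (ℤ/ℓ)ˣ ↠ ℤ/p`, under the
period transfer `Ω(W) = u · Ω⁺_{D.f}`, `|u|_p = 1` — so `∂^{(ν(n))}(δ̃) = 0 = ∂^{(∞)}(δ̃)` and
Cor. 1.7 reads `length_{ℤ_p} Ш(E/ℚ)[p^∞] = ord_p(L(E,1)/Ω(W))`: there is `q ∈ ℚ` with
`L(E,1)/Ω(W) = q` and `ord_p q = ord_p #Ш(E/ℚ)(p)`. Binders IDENTICAL to the PUBLISHED `p ≥ 5` tree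
fact `Kim2022_rankZero_padicValRat_sha_of_kuriharaNumber_ne_zero_of_maninConstant` except
`5 ≤ p → ρ̄_{E,p} onto` ↦ `3 ≤ p → ρ̄_{E,p^n} onto ∀ n`; use the published fact at `p ≥ 5`. The
`p = 3` case rests on Sakamoto, JTNB 36 (2024) (REFEREED). This is the shape in which the LOWER half
of the `p`-part of BSD at an additive `3` becomes ONE certificate per pair (Kim–Pollack App. A.1.1:
19215.x1, 22077.g1, 73206.r1, 83790.b1, 84825.y1 at `p = 3`, additive). NEVER cite this `Prop` as a
theorem; explicit hypothesis only. Weaker than the announced print, never stronger.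
[claim: Kim2025RefinedTNC, status: under-review]
[cite: Kim2025RefinedTNC, Thm. 1.1, Thm. 1.2 (rk0), Cor. 1.7 (PDF pp. 5–6), §1.1.2, Def. 2.4, §1.4.4, Rem. 2.3, §3.2.2, App. A.1.1 (pp. 33–34) (ANNOUNCED, typed as an OPEN hypothesis, nothing asserted)]
[cite: Sakamoto2024KolyvaginThree, Thm. 1.1 = Thm. 4.4 (p. 920)]
[cite: Kim2022StructureSelmer, §1.2.2, §1.2.5, §1.4.1–1.4.4, §1.5.1] -/
def rankZero_padicValRat_sha_of_kuriharaNumber_ne_zero_of_towerSurj_OPEN : Prop :=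
  ∀ (W : WeierstrassCurve ℚ) [W.IsElliptic] [W.IsGloballyMinimal] (p : ℕ) [Fact p.Prime],
    3 ≤ p → (∀ n : ℕ, W.HasSurjectiveModNGaloisRep (p ^ n : ℕ)) →
    W.entireLFunction 1 ≠ 0 → Finite W.sha →
    ∀ {N : ℕ} [NeZero N] (D : ModularParametrizationData W N),
    ¬ (p : ℤ) ∣ D.maninConstant →
    (∃ u : ℚ, ‖(u : ℚ_[p])‖ = 1 ∧ W.realPeriodRat = u * plusPeriod D.f) →
    ∀ (n : ℕ) [NeZero n], Kato.IsKolyvaginProduct W p 1 n →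
    (∀ (ℓ : ℕ) [Fact ℓ.Prime], ℓ ∣ n →
      Nat.card {P : ((WeierstrassCurve.integralModelInt W).map
          (Int.castRingHom (ZMod ℓ))).toAffine.Point // p • P = 0} ≤ p) →
    ∀ ψ : (ℓ : ℕ) → (ZMod ℓ)ˣ →* Multiplicative (ZMod (p ^ 1)),
      (∀ ℓ ∈ n.primeFactors, Function.Surjective (ψ ℓ)) →
      kuriharaNumber D.f (p ^ 1) n ψ ≠ 0 →
    ∃ q : ℚ, W.entireLFunction 1 / (W.realPeriodRat : ℂ) = (q : ℂ) ∧
      padicValRat p q = (padicValNat p (Nat.card (AddCommGroup.primaryComponent W.sha p)) : ℤ)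

/-- **OPEN HYPOTHESIS — UNREFEREED PREPRINT (arXiv:2505.09121v1, 2025), Thm. 1.1 (Str)/("BSD"),
weight `2`, analytic rank `1`, a UNIT Kurihara number at a PRIME Kolyvagin level: `Ш(E/ℚ)[p^∞] = 0`
at EVERY prime `p ≥ 3` under large `p`-adic image, ANY reduction type at `p`.** "Let
`f ∈ S_k(Γ₀(N))` be a newform and `p ≥ 3` a prime such that `ρ_f` has large image. If the
collection of Kurihara numbers … does not vanish, then … `cork_𝒪 Sel(ℚ, W_f^†) = ord(δ^{min,†})`,
`length_𝒪 Sel(ℚ, W_f^†)_{/div} = ∂^{(ord(δ^{min,†}))}(δ^{min,†}) − ∂^{(∞)}(δ^{min,†})`" (Thm. 1.1).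
Transcribed (module docstring, RANK ONE): `W/ℚ` globally minimal, `p ≥ 3` with `ρ̄_{E,p^n}` onto for
all `n`, `L(E,1) = 0` and `ord_{s=1} L(E,s) = 1`, `Ш(E/ℚ)` finite, `D` with `p ∤ c_D` and the period
transfer `Ω(W) = u·Ω⁺_{D.f}`, `|u|_p = 1`; `ℓ` a Kolyvagin prime of level `1` (`ℓ ∤ Np`, `ℓ ≡ 1`,
`a_ℓ ≡ ℓ + 1 (mod p)`) with `#Ẽ(𝔽_ℓ)[p] ≤ p` and `kuriharaNumber D.f p ℓ ψ ≠ 0` for a surjective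
`ψ_ℓ` (so `δ̃_1 = 0 ≠ δ̃_ℓ`: the collection does not vanish, `ord(δ̃) = 1`, `∂^{(1)} = ∂^{(∞)} = 0`);
then `cork Sel_{p^∞}(E/ℚ) = 1 = rk E(ℚ)`, `Sel_{/div} = 0`, hence `#Ш(E/ℚ)(p) = 1`. Binders
IDENTICAL to the PUBLISHED `p ≥ 5` tree fact
`Kim2022_rankOne_card_sha_eq_one_of_kuriharaNumber_ne_zero_of_maninConstant` except
`5 ≤ p → ρ̄_{E,p} onto` ↦ `3 ≤ p → ρ̄_{E,p^n} onto ∀ n`; use the published fact at `p ≥ 5`. The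
`p = 3` case rests on Sakamoto, JTNB 36 (2024) (REFEREED). Serves the cell's O7 ∩ X4@3 rows
(`r_an = 1`) per pair. NEVER cite this `Prop` as a theorem; explicit hypothesis only. Weaker than
the announced print, never stronger. [claim: Kim2025RefinedTNC, status: under-review]
[cite: Kim2025RefinedTNC, Thm. 1.1 (Str) and ("BSD") (PDF p. 5), §1.1.2–1.1.3, Def. 2.4, §1.4.4, Rem. 2.3, §3.2.2 (ANNOUNCED, typed as an OPEN hypothesis, nothing asserted)]
[cite: Sakamoto2024KolyvaginThree, Thm. 1.1 = Thm. 4.4 (p. 920)]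
[cite: Kim2022StructureSelmer, §1.2.2, §1.2.5, §1.4.3–1.4.4, §1.5.1] -/
def rankOne_card_sha_eq_one_of_kuriharaNumber_ne_zero_of_towerSurj_OPEN : Prop :=
  ∀ (W : WeierstrassCurve ℚ) [W.IsElliptic] [W.IsGloballyMinimal] (p : ℕ) [Fact p.Prime],
    3 ≤ p → (∀ n : ℕ, W.HasSurjectiveModNGaloisRep (p ^ n : ℕ)) →
    W.entireLFunction 1 = 0 → W.analyticRank = 1 → Finite W.sha →
    ∀ {N : ℕ} [NeZero N] (D : ModularParametrizationData W N),
    ¬ (p : ℤ) ∣ D.maninConstant →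
    (∃ u : ℚ, ‖(u : ℚ_[p])‖ = 1 ∧ W.realPeriodRat = u * plusPeriod D.f) →
    ∀ (ℓ : ℕ) [Fact ℓ.Prime], Kato.IsKolyvaginPrime W p 1 ℓ →
    Nat.card {P : ((WeierstrassCurve.integralModelInt W).map
        (Int.castRingHom (ZMod ℓ))).toAffine.Point // p • P = 0} ≤ p →
    ∀ ψ : (ℓ' : ℕ) → (ZMod ℓ')ˣ →* Multiplicative (ZMod (p ^ 1)),
      Function.Surjective (ψ ℓ) →
      kuriharaNumber D.f (p ^ 1) ℓ ψ ≠ 0 →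
    Nat.card (AddCommGroup.primaryComponent W.sha p) = 1

/-! ### Sanity: at `p ≥ 5` the OPEN large-image shapes are IMPLIED by the published facts

(The tower hypothesis at `n = 1` is `ρ̄_{E,p}` surjective, which is all the published `p ≥ 5` facts
need.) These two theorems assert nothing new: they record that the typed OPEN `Prop`s are, at
`p ≥ 5`, consequences of refereed print — so a consumer may feed the published facts where `5 ≤ p`. -/

/-- At `p ≥ 5` the OPEN inequality shape follows from the PUBLISHED Kim 2026 fact (tower at `n = 1`
is surj(p)). Bookkeeping only. [cite: Kim2022StructureSelmer, Thm. 1.9 (6) (PDF p. 8)] -/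
theorem rankZero_padicValNat_sha_le_of_towerSurj_of_five_le
    (hKim : Kim2026.rankZero_padicValNat_sha_le_of_maninConstant)
    (W : WeierstrassCurve ℚ) [W.IsElliptic] [W.IsGloballyMinimal] (p : ℕ) [Fact p.Prime]
    (hp : 5 ≤ p) (htower : ∀ n : ℕ, W.HasSurjectiveModNGaloisRep (p ^ n : ℕ))
    (hL : W.entireLFunction 1 ≠ 0) (hfin : Finite W.sha)
    {N : ℕ} [NeZero N] (D : ModularParametrizationData W N) (hc : ¬ (p : ℤ) ∣ D.maninConstant) :
    ∃ q : ℚ, W.entireLFunction 1 / (W.realPeriodRat : ℂ) = (q : ℂ) ∧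
      (padicValNat p (Nat.card (AddCommGroup.primaryComponent W.sha p)) : ℤ) ≤ padicValRat p q := by
  have h1 : W.HasSurjectiveModNGaloisRep p := by simpa using htower 1
  exact hKim W p hp h1 hL hfin D hc

/-- At `p ≥ 5` the OPEN unit-Kurihara-number shape follows from the PUBLISHED Kim 2026 fact.
Bookkeeping only. [cite: Kim2022StructureSelmer, Thm. 1.9 (1) and (6) (PDF pp. 7–8)] -/
theorem rankZero_padicValRat_sha_of_kuriharaNumber_ne_zero_of_towerSurj_of_five_le
    (hKim : Kim2022_rankZero_padicValRat_sha_of_kuriharaNumber_ne_zero_of_maninConstant)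
    (W : WeierstrassCurve ℚ) [W.IsElliptic] [W.IsGloballyMinimal] (p : ℕ) [Fact p.Prime]
    (hp : 5 ≤ p) (htower : ∀ n : ℕ, W.HasSurjectiveModNGaloisRep (p ^ n : ℕ))
    (hL : W.entireLFunction 1 ≠ 0) (hfin : Finite W.sha)
    {N : ℕ} [NeZero N] (D : ModularParametrizationData W N) (hc : ¬ (p : ℤ) ∣ D.maninConstant)
    (hper : ∃ u : ℚ, ‖(u : ℚ_[p])‖ = 1 ∧ W.realPeriodRat = u * plusPeriod D.f)
    (n : ℕ) [NeZero n] (hn : Kato.IsKolyvaginProduct W p 1 n)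
    (hcyc : ∀ (ℓ : ℕ) [Fact ℓ.Prime], ℓ ∣ n →
      Nat.card {P : ((WeierstrassCurve.integralModelInt W).map
          (Int.castRingHom (ZMod ℓ))).toAffine.Point // p • P = 0} ≤ p)
    (ψ : (ℓ : ℕ) → (ZMod ℓ)ˣ →* Multiplicative (ZMod (p ^ 1)))
    (hψ : ∀ ℓ ∈ n.primeFactors, Function.Surjective (ψ ℓ))
    (hδ : kuriharaNumber D.f (p ^ 1) n ψ ≠ 0) :
    ∃ q : ℚ, W.entireLFunction 1 / (W.realPeriodRat : ℂ) = (q : ℂ) ∧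
      padicValRat p q = (padicValNat p (Nat.card (AddCommGroup.primaryComponent W.sha p)) : ℤ) := by
  have h1 : W.HasSurjectiveModNGaloisRep p := by simpa using htower 1
  exact hKim W p hp h1 hL hfin D hc hper n hn hcyc ψ hψ hδ

/-! ### APPEND (n1011-p09, referee-1 ruling RA3 (i)/(ii), 2026-08-21): the same announced statement
in [K25]'s OWN currency — INTEGRAL PERIODS of the modular symbols, NO Manin binder, NO Néron period

Referee 1 of team n1011 (`cells/n1011/REFEREE-1.md`, RA3) ruled that the Kim 2025 statement be typed
FIRST "in [K25]'s own currency — period datum = minimal integral periods `Ω^±_{f,min}`, NO Manin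
binder, `3 ≤ p`, tower — as close to verbatim as the tree's modular-symbol vocabulary allows", and
that the `Ω(W)`-normalised / Manin-datum shapes above be presented as DERIVED from it modulo the
`p`-integrality of the `Ω(W)`-normalised symbols (Kim AJM §1.4.1), never as [K25] verbatim. The two
`Prop`s below do the first; the flag on the three `Prop`s above is recorded here: **FLAG
`Kim2025-OmegaE-integrality`** — `rankZero_padicValNat_sha_le_of_towerSurj_OPEN`,
`rankZero_padicValRat_sha_of_kuriharaNumber_ne_zero_of_towerSurj_OPEN` and
`rankOne_card_sha_eq_one_of_kuriharaNumber_ne_zero_of_towerSurj_OPEN` are WEAKER-THAN-PRINT SHAPES OF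
[K25] MODULO the integrality "`[r]⁺_E ∈ ℤ_(p)` under large image and `p ∤ c_D`" (Kim AJM 148 §1.4.1
standing claim; Manin 1972 Thm. 3.5 via Sakamoto JTNB 2024 §9.2.2; the two-line derivation is in the
module docstring, RANK ZERO / PERIOD) — the kernel bridge from the own-currency `Prop` below to the
`Ω(W)` shape under the explicit binders [period transfer `Ω(W) = u·Ω⁺_f`, `|u|_p = 1`] ∧
[`Ω⁺_f`-integrality of all `[r]⁺_f`] is the cell theorem
`Summit.BirchSwinnertonDyer.Rank1Residual.Additive.rankZero_padicValNat_sha_le_of_integralPeriod_of_periodTransfer`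
(file `Summits/…/Additive/X4KimLargeImageIntegralPeriod.lean`).

DICTIONARY for the own-currency shapes (k = 2, `𝒪 = ℤ_p`, `f = f_E` with rational coefficients, so
every plus symbol is a rational multiple of `Ω⁺_f = plusPeriod f`: `re{∞, r}_f = [r]⁺_f · Ω⁺_f` with
`[r]⁺_f = ratPlusSymbol f r ∈ ℚ`, Manin–Drinfeld / `ratCast_ratPlusSymbol`). Kim's period integrals
`λ_f(z⁰; a, n) = √−1 ∫₀^∞ f(iy + a/n) dy` and `λ^±` (§2.3.1) are `(√−1/2π)·{∞, a/n}_f` and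
`(√−1/2π)·plusSymbol f (a/n)`, so an "integral period" `Ω` for the plus symbols (Def. 2.2 / Rem. 2.3:
`λ^+(z⁰; a, n)/Ω ∈ 𝒪` for all `a, n`) is, up to the harmless constant `√−1/2π` and a unit, a real
number `Ω = p^v · Ω⁺_f · (p-adic unit)` with `v ≤ ord_p [r]⁺_f` for every `r ∈ ℚ` with `[r]⁺_f ≠ 0`;
it is MINIMAL when `v` is the minimum. In analytic rank `0`, Cor. 1.7 with such an `Ω` (§1.4.4: "Any
non-minimal integral periods can play the exactly same role … without any modification") reads
`length_{ℤ_p} Ш(E/ℚ)[p^∞] = ord_p(L(f,1)/Ω) − ∂^{(∞)}(δ^Ω) = (ord_p [0]⁺_f − v) − ∂^{(∞)}(δ^Ω)` with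
`∂^{(∞)}(δ^Ω) ≥ 0` (all `δ^Ω_n ∈ 𝒪`), where `[0]⁺_f = L(f,1)/Ω⁺_f = L(E,1)/Ω⁺_f`
(`IsNewformOf.entireLFunction_one_eq`) and `Sel(ℚ, W_f(1)) = Ш(E/ℚ)[p^∞]` (rank `0`). -/

/-- **OPEN HYPOTHESIS — UNREFEREED PREPRINT (arXiv:2505.09121v1, 2025), Cor. 1.7 (with Thm. 1.1
("BSD"), Thm. 1.2 (rk0), Def. 2.2, Rem. 2.3, §1.4.4) IN ITS OWN CURRENCY: integral periods of the
modular symbols, no Manin constant, no Néron period.** "Let `f ∈ S_k(Γ₀(N))` be a newform and `p ≥ 3`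
a prime such that `ρ_f` has large image. If `L(f, k/2) ≠ 0`, then `length_𝒪 Sel(ℚ, W_f^†) =
ord_π( L(f̄,k/2)/((−2π√−1)^{k/2}·Ω^±_{f̄,min}) ) − ∂^{(∞)}(δ^{min,†})`", "Any non-minimal integral
periods can play the exactly same role". Transcribed at `k = 2` (section docstring DICTIONARY): `W/ℚ`
globally minimal elliptic with newform `f`, `p ≥ 3` with `ρ̄_{E,p^n}` onto for all `n` (⇒ large
image), `L(E,1) ≠ 0`, `Ш(E/ℚ)` finite; for EVERY exponent `v ∈ ℤ` making `p^v·Ω⁺_f` an integral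
period of the plus symbols — `v ≤ ord_p [r]⁺_f` for all `r ∈ ℚ` with `[r]⁺_f ≠ 0` —:
`ord_p #Ш(E/ℚ)(p) ≤ ord_p [0]⁺_f − v` (`= ord_p(L(E,1)/(p^v Ω⁺_f)) − ∂^{(∞)}`, `∂^{(∞)} ≥ 0`). The
`p = 3` case rests on Sakamoto, JTNB 36 (2024) Thm. 1.1 (REFEREED). NEVER cite this `Prop` as a
theorem; explicit hypothesis only. Weaker than the announced print (inequality; `Finite W.sha`; full
tower for large image), never stronger. [claim: Kim2025RefinedTNC, status: under-review]
[cite: Kim2025RefinedTNC, Cor. 1.7 (PDF p. 6), Thm. 1.1, Thm. 1.2 (rk0), §1.4.4, Def. 2.2, Rem. 2.3, §2.3.1, §3.2.2 (ANNOUNCED, typed as an OPEN hypothesis, nothing asserted)]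
[cite: Sakamoto2024KolyvaginThree, Thm. 1.1 = Thm. 4.4 (p. 920)] -/
def cor17_rankZero_padicValNat_sha_le_of_integralPeriod_OPEN : Prop :=
  ∀ (W : WeierstrassCurve ℚ) [W.IsElliptic] [W.IsGloballyMinimal] (p : ℕ) [Fact p.Prime],
    3 ≤ p → (∀ n : ℕ, W.HasSurjectiveModNGaloisRep (p ^ n : ℕ)) →
    W.entireLFunction 1 ≠ 0 → Finite W.sha →
    ∀ {N : ℕ} [NeZero N] (f : CuspForm (Gamma0 N) 2), IsNewformOf W f →
    ∀ v : ℤ, (∀ r : ℚ, ratPlusSymbol f r ≠ 0 → v ≤ padicValRat p (ratPlusSymbol f r)) →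
    (padicValNat p (Nat.card (AddCommGroup.primaryComponent W.sha p)) : ℤ) ≤
      padicValRat p (ratPlusSymbol f 0) - v

/-- **OPEN HYPOTHESIS — UNREFEREED PREPRINT (arXiv:2505.09121v1, 2025), Thm. 1.1 ("BSD") / Cor. 1.7
IN ITS OWN CURRENCY, a UNIT Kurihara number: the EQUALITY `ord_p #Ш(E/ℚ)(p) = ord_p [0]⁺_f` when
`Ω⁺_f` is itself an integral period.** Same announced statement; here `v = 0` is admissible
(`0 ≤ ord_p [r]⁺_f` for every `r` with `[r]⁺_f ≠ 0`, i.e. `Ω⁺_f` is a (possibly non-minimal)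
integral period, so every `Ω⁺_f`-normalised Kurihara number `kuriharaNumber f (p^k) n ψ` is a genuine
reduction of a `p`-integral number) and ONE cyclic level `n ∈ 𝒩_1` (`ℓ ∤ Np`, `ℓ ≡ 1`,
`a_ℓ ≡ ℓ + 1 (mod p)`, `#Ẽ(𝔽_ℓ)[p] ≤ p` — the printed proof's useful primes) carries a unit:
`kuriharaNumber f p n ψ ≠ 0` for surjective discrete logarithms `ψ_ℓ`. Then `Ω⁺_f` is minimal
(`v = 0` is the minimum), `∂^{(ν(n))}(δ^{min}) = 0 = ∂^{(∞)}(δ^{min})`, and Cor. 1.7 reads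
`length_{ℤ_p} Ш(E/ℚ)[p^∞] = ord_p(L(f,1)/Ω⁺_f) = ord_p [0]⁺_f`. The `p = 3` case rests on Sakamoto
2024 (REFEREED). NEVER cite this `Prop` as a theorem; explicit hypothesis only. Weaker than the
announced print, never stronger. [claim: Kim2025RefinedTNC, status: under-review]
[cite: Kim2025RefinedTNC, Thm. 1.1 ("BSD"), Cor. 1.7, §1.1.2, Def. 2.2, Def. 2.4, Rem. 2.3, §1.4.4, §3.2.2 (ANNOUNCED, typed as an OPEN hypothesis, nothing asserted)]
[cite: Sakamoto2024KolyvaginThree, Thm. 1.1 = Thm. 4.4 (p. 920)] -/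
def cor17_rankZero_padicValRat_sha_eq_of_kuriharaNumber_ne_zero_of_integralPeriod_OPEN : Prop :=
  ∀ (W : WeierstrassCurve ℚ) [W.IsElliptic] [W.IsGloballyMinimal] (p : ℕ) [Fact p.Prime],
    3 ≤ p → (∀ n : ℕ, W.HasSurjectiveModNGaloisRep (p ^ n : ℕ)) →
    W.entireLFunction 1 ≠ 0 → Finite W.sha →
    ∀ {N : ℕ} [NeZero N] (f : CuspForm (Gamma0 N) 2), IsNewformOf W f →
    (∀ r : ℚ, ratPlusSymbol f r ≠ 0 → 0 ≤ padicValRat p (ratPlusSymbol f r)) →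
    ∀ (n : ℕ) [NeZero n], Kato.IsKolyvaginProduct W p 1 n →
    (∀ (ℓ : ℕ) [Fact ℓ.Prime], ℓ ∣ n →
      Nat.card {P : ((WeierstrassCurve.integralModelInt W).map
          (Int.castRingHom (ZMod ℓ))).toAffine.Point // p • P = 0} ≤ p) →
    ∀ ψ : (ℓ : ℕ) → (ZMod ℓ)ˣ →* Multiplicative (ZMod (p ^ 1)),
      (∀ ℓ ∈ n.primeFactors, Function.Surjective (ψ ℓ)) →
      kuriharaNumber f (p ^ 1) n ψ ≠ 0 →
    (padicValNat p (Nat.card (AddCommGroup.primaryComponent W.sha p)) : ℤ) =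
      padicValRat p (ratPlusSymbol f 0)

end Literature.NumberTheory.EllipticCurves.Kim2025

end
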